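import Summits.KontsevichZagierPeriods.Zeta5Search.WedgeDictionaryRankTwo
import HarnessLib

/-!
# The three-term coordinate relation on the face `b₇ = 0` of the wedge dictionary (cell `pub-zeta5`)

HONEST FRAMING: systematic search; no irrationality claim unless certified.

OUR work (Summit side; lead/literature seat generation 4 wearing the lead hat, 2026-08-20). First of three files
(`WedgeDictionaryFaceRelation` → `WedgeDictionaryFaceAbel` → `WedgeDictionaryFace`) proving the conjecture
`casoratianClosedForm` (CF-M3, gen-1 g4, `WedgeDictionaryClosedForms`) on the WHOLE FACE `{b₇ = 0}` — six free
parameters `b₁,…,b₆` besides the level `N = b₀` — by ONE uniform argument (previously: corner `(N;0⁷)`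
`cornerIdentity`, edge `(N;1,0⁶)`, fan `(N;k,0⁶)` for `k ≤ 3`, one certificate per family).

This file: the **three-term coordinate relation** (`face_threeTerm`). For `b` on the face and a direction
`j ≤ 6`, `d(b)·R_{b+2e_j} + γ₁·R_{b+e_j} + γ₀·R_b` is SUMMABLE. With `x = t+1`, `N = b₀`,
`h_b(x) = ∏_j (x)_{b_j} (x+N−b_j)_{b_j}` (`hPoly`) and `p(u) = ∏_{k≤6} (u − b_k)` one has the polynomial identity
`(p(x+N) − p(−x)) · ∏_j (x)_{b_j}(x+N−b_j+1)_{b_j} = h_b(x)(x+N)⁶ − h_b(x+1)x⁶`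
(the slot `b₇ = 0` supplies the missing factors `x` and `x+N`), and `(p(x+N) − p(−x))/(2x+N)` is a quadratic in
`y = x(x+N)` whose Newton expansion at the nodes `y_s = −s(N−s)`, `s = b_j, b_j+1`, has leading coefficient
`d(b) = 3N − Σ_k b_k` and value `γ₀ = ∏_{k≤6, k≠j} (N − b_j − b_k)` (`faceGamma0`) at `y_{b_j}`
(`face_scalar_identity`, one `ring` per direction); since `Π_{b+e_j} = (y − y_{b_j})·Π_b`
(`numPoly_update`), this is the displayed three-term combination with telescoper `g = −h_b`.

Why only the faces: with all seven `b_j ≥ 1` the same manipulation produces `(x+N)⁷h_b(x) + x⁷h_b(x+1)`, not of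
the summable shape; in the interior the three-term coefficients carry the contiguous ratios of the terminating
very-well-poised `₉F₈` `Ω(b)` (memo `HOME/pub-zeta5-lit-g4/CFM3-LIT.md`).
-/

noncomputable section

open Finset Polynomial

namespace Summit.KontsevichZagierPeriods.Zeta5Search.WedgeDictionary

open Summit.KontsevichZagierPeriods.Zeta5Search.DualSeries
open Literature.NumberTheory.Transcendental
open Literature.NumberTheory.Transcendental.BallRivoal (pfEval pf_unique poch_pos pochPoly eval_pochPoly pfEval_sub'
  pfEval_const_mul pfEval_add)
open Literature.NumberTheory.Irrationality.CressonFischlerRivoal2008 (exists_pf_data)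

/-! ### The coordinate step `b ↦ b + e_{i+1}` -/

/-- `bump b i = b + e_{i+1}` (raise the slot `b_{i+1}` by one). -/
def bump (b : ℕ → ℤ) (i : ℕ) : ℕ → ℤ := Function.update b (i + 1) (b (i + 1) + 1)

/-- `(bump b i) 0 = b 0`. -/
theorem bump_zero (b : ℕ → ℤ) (i : ℕ) : bump b i 0 = b 0 := Function.update_of_ne (by omega) _ _

/-- `(bump b i) (i+1) = b (i+1) + 1`. -/
theorem bump_self (b : ℕ → ℤ) (i : ℕ) : bump b i (i + 1) = b (i + 1) + 1 := Function.update_self _ _ _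

/-- `(bump b i) k = b k` for `k ≠ i+1`. -/
theorem bump_of_ne (b : ℕ → ℤ) {i k : ℕ} (h : k ≠ i + 1) : bump b i k = b k := Function.update_of_ne h _ _

/-! ### The telescoper of the face relation -/

/-- `h_b = ∏_{j<7} (X)_{b_j} · (X + N − b_j)_{b_j}` (`N = b₀`); the face relation telescopes with `g = −h_b`. -/
def hPoly (b : ℕ → ℤ) : ℚ[X] :=
  ∏ j ∈ range 7, pochPoly 0 (b (j + 1)).toNat * pochPoly ((b 0 - b (j + 1) : ℤ) : ℚ) (b (j + 1)).toNat

/-- The constant coefficient of the three-term relation in direction `i+1`: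
`γ₀(b,i) = ∏_{k<6, k≠i} (N − b_{i+1} − b_{k+1})`. -/
def faceGamma0 (b : ℕ → ℤ) (i : ℕ) : ℚ :=
  ∏ k ∈ range 6, if k = i then (1 : ℚ) else ((b 0 : ℚ) - b (i + 1) - b (k + 1))

/-- `e₁` of the six slots `b₁,…,b₆` (explicit sum). -/
def fe1 (b : ℕ → ℤ) : ℚ := (b 1 : ℚ) + (b 2 : ℚ) + (b 3 : ℚ) + (b 4 : ℚ) + (b 5 : ℚ) + (b 6 : ℚ)

/-- `e₂` of the six slots `b₁,…,b₆` (explicit sum of the 15 products `b_j b_k`, `j<k`). -/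
def fe2 (b : ℕ → ℤ) : ℚ :=
  (b 1 : ℚ) * (b 2 : ℚ) + (b 1 : ℚ) * (b 3 : ℚ) + (b 1 : ℚ) * (b 4 : ℚ) + (b 1 : ℚ) * (b 5 : ℚ) +
    (b 1 : ℚ) * (b 6 : ℚ) + (b 2 : ℚ) * (b 3 : ℚ) + (b 2 : ℚ) * (b 4 : ℚ) + (b 2 : ℚ) * (b 5 : ℚ) +
    (b 2 : ℚ) * (b 6 : ℚ) + (b 3 : ℚ) * (b 4 : ℚ) + (b 3 : ℚ) * (b 5 : ℚ) + (b 3 : ℚ) * (b 6 : ℚ) +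
    (b 4 : ℚ) * (b 5 : ℚ) + (b 4 : ℚ) * (b 6 : ℚ) + (b 5 : ℚ) * (b 6 : ℚ)

/-- `e₃` of the six slots `b₁,…,b₆` (explicit sum of the 20 products `b_j b_k b_l`, `j<k<l`). -/
def fe3 (b : ℕ → ℤ) : ℚ :=
  (b 1 : ℚ) * (b 2 : ℚ) * (b 3 : ℚ) + (b 1 : ℚ) * (b 2 : ℚ) * (b 4 : ℚ) + (b 1 : ℚ) * (b 2 : ℚ) * (b 5 : ℚ) +
    (b 1 : ℚ) * (b 2 : ℚ) * (b 6 : ℚ) + (b 1 : ℚ) * (b 3 : ℚ) * (b 4 : ℚ) + (b 1 : ℚ) * (b 3 : ℚ) * (b 5 : ℚ) +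
    (b 1 : ℚ) * (b 3 : ℚ) * (b 6 : ℚ) + (b 1 : ℚ) * (b 4 : ℚ) * (b 5 : ℚ) + (b 1 : ℚ) * (b 4 : ℚ) * (b 6 : ℚ) +
    (b 1 : ℚ) * (b 5 : ℚ) * (b 6 : ℚ) + (b 2 : ℚ) * (b 3 : ℚ) * (b 4 : ℚ) + (b 2 : ℚ) * (b 3 : ℚ) * (b 5 : ℚ) +
    (b 2 : ℚ) * (b 3 : ℚ) * (b 6 : ℚ) + (b 2 : ℚ) * (b 4 : ℚ) * (b 5 : ℚ) + (b 2 : ℚ) * (b 4 : ℚ) * (b 6 : ℚ) +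
    (b 2 : ℚ) * (b 5 : ℚ) * (b 6 : ℚ) + (b 3 : ℚ) * (b 4 : ℚ) * (b 5 : ℚ) + (b 3 : ℚ) * (b 4 : ℚ) * (b 6 : ℚ) +
    (b 3 : ℚ) * (b 5 : ℚ) * (b 6 : ℚ) + (b 4 : ℚ) * (b 5 : ℚ) * (b 6 : ℚ)

/-- The middle coefficient of the three-term relation in direction `i+1`:
`γ₁ = q₁ + d·(y_{b} + y_{b+1})` with `q₁ = 4N³ − 3e₁N² + 2e₂N − e₃`, `y_s = −s(N−s)`, `s = b_{i+1}`. -/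
def faceGamma1 (b : ℕ → ℤ) (i : ℕ) : ℚ :=
  (4 * (b 0 : ℚ) ^ 3 - 3 * fe1 b * (b 0 : ℚ) ^ 2 + 2 * fe2 b * (b 0 : ℚ) - fe3 b) +
    (dOf b : ℚ) * (-(b (i + 1) : ℚ) * ((b 0 : ℚ) - b (i + 1)) +
      -((b (i + 1) : ℚ) + 1) * ((b 0 : ℚ) - b (i + 1) - 1))

/-! ### Pochhammer bookkeeping for one slot -/

/-- `(x)_m (x+N−m+1)_m · (x+N−m) = (x)_m (x+N−m)_m · (x+N)` (as soon as `m = β`). -/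
theorem slot_shift_N (x N β : ℚ) (m : ℕ) (hm : (m : ℚ) = β) :
    BallRivoal.poch x m * BallRivoal.poch (x + (N - β + 1)) m * (x + (N - β)) =
      BallRivoal.poch x m * BallRivoal.poch (x + (N - β)) m * (x + N) := by
  have h1 := poch_succ_right (x + (N - β)) m
  have h2 := poch_succ_left (x + (N - β)) m
  rw [hm] at h1
  rw [show x + (N - β) + 1 = x + (N - β + 1) by ring] at h2
  have key : BallRivoal.poch (x + (N - β + 1)) m * (x + (N - β)) = BallRivoal.poch (x + (N - β)) m * (x + N) := by
    have := h1.symm.trans h2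
    linear_combination -this
  rw [mul_assoc, key, ← mul_assoc]

/-- `(x)_m (x+N−m+1)_m · (x+m) = (x+1)_m (x+1+N−m)_m · x` (as soon as `m = β`). -/
theorem slot_shift_zero (x N β : ℚ) (m : ℕ) (hm : (m : ℚ) = β) :
    BallRivoal.poch x m * BallRivoal.poch (x + (N - β + 1)) m * (x + β) =
      BallRivoal.poch (x + 1) m * BallRivoal.poch (x + 1 + (N - β)) m * x := by
  have h1 := poch_succ_right x m
  have h2 := poch_succ_left x m
  rw [hm] at h1
  have key : BallRivoal.poch x m * (x + β) = x * BallRivoal.poch (x + 1) m := h1.symm.trans h2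
  rw [show x + 1 + (N - β) = x + (N - β + 1) by ring]
  linear_combination BallRivoal.poch (x + (N - β + 1)) m * key

/-! ### The polynomial identity behind the three-term relation (one `ring` per direction) -/

/-- The scalar identity `(2x+N)·[d(x+β)(x+β+1)(x+N−β−1)(x+N−β) + γ₁(x+β)(x+N−β) + γ₀] = ∏_{k≤6}(x+N−b_k) − ∏_{k≤6}(x+b_k)`
for the six slots of the face and each direction `i < 6`. -/
theorem face_scalar_identity (b : ℕ → ℤ) {i : ℕ} (hi : i ∈ range 6) (h7 : b 7 = 0) (x : ℚ) :
    (2 * x + (b 0 : ℚ)) *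
        ((dOf b : ℚ) * ((x + (b (i + 1) : ℚ)) * (x + ((b 0 : ℚ) - b (i + 1))) *
            ((x + ((b (i + 1) : ℚ) + 1)) * (x + ((b 0 : ℚ) - b (i + 1) - 1)))) +
          faceGamma1 b i * ((x + (b (i + 1) : ℚ)) * (x + ((b 0 : ℚ) - b (i + 1)))) + faceGamma0 b i) =
      (∏ k ∈ range 6, (x + ((b 0 : ℚ) - b (k + 1)))) - ∏ k ∈ range 6, (x + (b (k + 1) : ℚ)) := by
  have hd : (dOf b : ℚ) = 3 * (b 0 : ℚ) - ((b 1 : ℚ) + (b 2 : ℚ) + (b 3 : ℚ) + (b 4 : ℚ) + (b 5 : ℚ) + (b 6 : ℚ)) := by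
    unfold dOf
    simp only [sum_range_succ, sum_range_zero, h7]
    push_cast
    ring
  have hi' : i < 6 := mem_range.1 hi
  interval_cases i <;>
    simp only [faceGamma1, faceGamma0, fe1, fe2, fe3, prod_range_succ, prod_range_zero, hd] <;> norm_num <;> ring


/-! ### The three-term relation on the face as a polynomial identity -/

/-- Product form of `h_b(x)·(x+N)⁷` on the face: `h_b(x)(x+N)⁷ = A_b(x)·(∏_{k≤6}(x+N−b_k))·(x+N)`,
`A_b(x) = ∏_j (x)_{b_j}(x+N−b_j+1)_{b_j}` the Pochhammer part of `numPoly b`. -/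
theorem hPoly_eval_mul (b : ℕ → ℤ) (hb : InBox b) (h7 : b 7 = 0) (x : ℚ) :
    (∏ j ∈ range 7, (BallRivoal.poch x (b (j + 1)).toNat *
        BallRivoal.poch (x + ((b 0 - b (j + 1) : ℤ) : ℚ)) (b (j + 1)).toNat)) * (x + (b 0 : ℚ)) ^ 7 =
      (∏ j ∈ range 7, (BallRivoal.poch x (b (j + 1)).toNat *
        BallRivoal.poch (x + ((b 0 - b (j + 1) + 1 : ℤ) : ℚ)) (b (j + 1)).toNat)) *
        ((∏ k ∈ range 6, (x + ((b 0 : ℚ) - b (k + 1)))) * (x + (b 0 : ℚ))) := by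
  have h67 : b (6 + 1) = 0 := h7
  rw [show (x + (b 0 : ℚ)) ^ 7 = ∏ _j ∈ range 7, (x + (b 0 : ℚ)) by rw [prod_const, card_range],
    ← prod_mul_distrib]
  rw [show (∏ k ∈ range 6, (x + ((b 0 : ℚ) - b (k + 1)))) * (x + (b 0 : ℚ)) =
      ∏ j ∈ range 7, (x + ((b 0 : ℚ) - b (j + 1))) by
      conv_rhs => rw [prod_range_succ]
      rw [h67]; push_cast; ring,
    ← prod_mul_distrib]
  refine prod_congr rfl fun j hj => ?_
  have hm : (((b (j + 1)).toNat : ℕ) : ℚ) = (b (j + 1) : ℚ) := by exact_mod_cast Int.toNat_of_nonneg (hb.2 j hj).1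
  have key := slot_shift_N x (b 0 : ℚ) (b (j + 1) : ℚ) (b (j + 1)).toNat hm
  push_cast
  linear_combination (-1 : ℚ) * key

/-- Product form of `h_b(x+1)·x⁷` on the face: `h_b(x+1)x⁷ = A_b(x)·(∏_{k≤6}(x+b_k))·x`. -/
theorem hPoly_eval_succ_mul (b : ℕ → ℤ) (hb : InBox b) (h7 : b 7 = 0) (x : ℚ) :
    (∏ j ∈ range 7, (BallRivoal.poch (x + 1) (b (j + 1)).toNat *
        BallRivoal.poch (x + 1 + ((b 0 - b (j + 1) : ℤ) : ℚ)) (b (j + 1)).toNat)) * x ^ 7 =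
      (∏ j ∈ range 7, (BallRivoal.poch x (b (j + 1)).toNat *
        BallRivoal.poch (x + ((b 0 - b (j + 1) + 1 : ℤ) : ℚ)) (b (j + 1)).toNat)) *
        ((∏ k ∈ range 6, (x + (b (k + 1) : ℚ))) * x) := by
  have h67 : b (6 + 1) = 0 := h7
  rw [show x ^ 7 = ∏ _j ∈ range 7, x by rw [prod_const, card_range], ← prod_mul_distrib]
  rw [show (∏ k ∈ range 6, (x + (b (k + 1) : ℚ))) * x = ∏ j ∈ range 7, (x + (b (j + 1) : ℚ)) by
      conv_rhs => rw [prod_range_succ]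
      rw [h67]; push_cast; ring,
    ← prod_mul_distrib]
  refine prod_congr rfl fun j hj => ?_
  have hm : (((b (j + 1)).toNat : ℕ) : ℚ) = (b (j + 1) : ℚ) := by exact_mod_cast Int.toNat_of_nonneg (hb.2 j hj).1
  have key := slot_shift_zero x (b 0 : ℚ) (b (j + 1) : ℚ) (b (j + 1)).toNat hm
  push_cast
  linear_combination (-1 : ℚ) * key

/-- `h_b(x) = ∏_j (x)_{b_j}(x+N−b_j)_{b_j}` evaluated. -/
theorem eval_hPoly (b : ℕ → ℤ) (x : ℚ) :
    (hPoly b).eval x = ∏ j ∈ range 7, (BallRivoal.poch x (b (j + 1)).toNat *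
      BallRivoal.poch (x + ((b 0 - b (j + 1) : ℤ) : ℚ)) (b (j + 1)).toNat) := by
  unfold hPoly
  rw [eval_prod]
  refine prod_congr rfl fun j _ => ?_
  rw [eval_mul, eval_pochPoly, eval_pochPoly, add_zero]

/-- **The three-term coordinate relation on the face, as a polynomial identity.** For `b` in the box with
`b₇ = 0` and a direction `i < 6`:
`d(b)·numPoly(b+2e_{i+1}) + γ₁·numPoly(b+e_{i+1}) + γ₀·numPoly(b) = g(X+1)X⁶ − g(X)(X+N)⁶` with `g = −h_b`. -/
theorem face_threeTerm (b : ℕ → ℤ) (hb : InBox b) (h7 : b 7 = 0) {i : ℕ} (hi : i ∈ range 6) :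
    C (dOf b : ℚ) * numPoly (bump (bump b i) i) + C (faceGamma1 b i) * numPoly (bump b i) +
        C (faceGamma0 b i) * numPoly b =
      (-hPoly b).comp (X + C 1) * X ^ 6 - (-hPoly b) * (X + C (((b 0).toNat : ℕ) : ℚ)) ^ 6 := by
  have hi7 : i ∈ range 7 := by have := mem_range.1 hi; exact mem_range.2 (by omega)
  have hβ0 : 0 ≤ b (i + 1) := (hb.2 i hi7).1
  have hN : (((b 0).toNat : ℕ) : ℚ) = (b 0 : ℚ) := by exact_mod_cast Int.toNat_of_nonneg hb.1
  have e1 : numPoly (bump b i) = numPoly b * ((X + C (b (i + 1) : ℚ)) * (X + C ((b 0 - b (i + 1) : ℤ) : ℚ))) :=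
    numPoly_update b hi7 hβ0
  have e2 : numPoly (bump (bump b i) i) =
      numPoly (bump b i) * ((X + C (bump b i (i + 1) : ℚ)) * (X + C ((bump b i 0 - bump b i (i + 1) : ℤ) : ℚ))) :=
    numPoly_update (bump b i) hi7 (by rw [bump_self]; omega)
  rw [bump_self, bump_zero] at e2
  -- it suffices to prove the identity after multiplication by the nonzero polynomial `(X + N)·X`
  suffices hmain : (X + C (b 0 : ℚ)) * X *
      (C (dOf b : ℚ) * numPoly (bump (bump b i) i) + C (faceGamma1 b i) * numPoly (bump b i) +
          C (faceGamma0 b i) * numPoly b -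
        ((-hPoly b).comp (X + C 1) * X ^ 6 - (-hPoly b) * (X + C (((b 0).toNat : ℕ) : ℚ)) ^ 6)) = 0 by
    have hne : (X + C (b 0 : ℚ)) * X ≠ 0 := mul_ne_zero (X_add_C_ne_zero _) X_ne_zero
    exact sub_eq_zero.1 ((mul_eq_zero.1 hmain).resolve_left hne)
  apply Polynomial.funext
  intro x
  have hHA := hPoly_eval_mul b hb h7 x
  have hH1A := hPoly_eval_succ_mul b hb h7 x
  have estar := face_scalar_identity b hi h7 x
  rw [e2, e1]
  simp only [eval_mul, eval_add, eval_sub, eval_neg, eval_comp, eval_pow, eval_C, eval_X, eval_zero,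
    eval_numPoly, eval_hPoly, hN]
  push_cast at hHA hH1A ⊢
  linear_combination ((∏ j ∈ range 7, (BallRivoal.poch x (b (j + 1)).toNat *
      BallRivoal.poch (x + ((b 0 : ℚ) - (b (j + 1) : ℚ) + 1)) (b (j + 1)).toNat)) * x * (x + (b 0 : ℚ))) * estar +
    (x + (b 0 : ℚ)) * hH1A - x * hHA

end Summit.KontsevichZagierPeriods.Zeta5Search.WedgeDictionary
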